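import Summits.BirchSwinnertonDyer.BirchSwinnertonDyer.Theorems.CMKolyvaginAtInertTwoLowerLevelTwoReciprocityAtTwo
import HarnessLib

/-!
# Route `CMKolyvaginAtInertTwo`, crux `CMKolyvaginExactAtInertTwo` (stmt-BirchSwinnertonDyer-24277), `stub_lower` — W-UP on H₂,
# FILE W3b: THE ONE-STEP ENGINE AT LEVEL `2`, ASSEMBLED — a `k`-minimal primitive Kolyvagin product with a SHALLOW own prime is
# impossible, modulo named `K`-side inputs (McCallum's prime swap over `ℚ` at level `2`, all own primes GROSS)

Seat `bsd-line-cmk2-p1` g19 (cell `bsd-print-cf2`), `--supports stmt-BirchSwinnertonDyer-24277` (helper; closes nothing).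
THEOREMS ONLY (no definition, no named fact, no `sorry`).  BSD is NOT proved by any of this; the crux is not closed here.

WHY: see file W3a `…LowerLevelTwoReciprocityAtTwo` (auxiliary + reciprocity).  THIS FILE: §4 the local inputs at level `2` — the
`ℓ′`-term does NOT vanish (`invWeilPairing_localization_ne_zero_of_newPrime_two`: `loc y` generates the Lagrangian Kummer line,
`loc Z ∉ 𝓛`), the shallow-own-prime term vanishes (`localization_eq_zero_of_K_two`: Q2's second clause against the VANISHING swapped
class + gk2-p3's dictionary at `M = 1`); §5 **`false_of_levelTwo_engine`** — gk2 LEAD g16's `false_of_bottomRung_engine` at level `2`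
WITHOUT the doubling `X = 2Z`: the genus place is killed by `y_u = 0`, the Kummer membership of `Z` over `ℚ` by the displayed descent
plumbing `hdesc` (ty2's `RationalDescentPlumbing.hdescfin_of_heegner_prime_discr` on H₂ with prime `|d_K|`) and g8's archimedean
vanishing (`Δ < 0`).  Every arithmetic input is DISPLAYED on `K`-side classes (Q2 at `λ′` and at the shallow `λ`, the Čebotarev
clauses, (Kum), (desc), (tr), imprimitivity of the swaps) — the list the closure file discharges by name on H₂.

References: [McCallumLMS1991] §4 Prop. 4.4, §5 Lemma 5.3 and proof of Prop. 5.2; [GrossLMS1991] Prop. 6.2, §9; [MilneADT2006] I Thm. 4.10.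
-/

set_option autoImplicit false
-- the Theorems namespace of this sub repeats the summit name by design (D-0017 nested layout)
set_option linter.dupNamespace false

noncomputable section

open scoped Classical

open Field NumberField IsDedekindDomain Function WeierstrassCurve
open Literature.NumberTheory.EllipticCurves
open Literature.NumberTheory.GaloisRepresentations
open Literature.NumberTheory.GaloisCohomology
open Summit.BirchSwinnertonDyer.Rank1Residual.X11b.KummerPT
open Summit.BirchSwinnertonDyer.Rank1Residual.X11b.FiniteDuality
open Summit.BirchSwinnertonDyer.Rank1Residual.X11b.Relaxation

namespace Summit.BirchSwinnertonDyer.BirchSwinnertonDyer.Theorems.KolyvaginLowerTwo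

open Summit.BirchSwinnertonDyer.BirchSwinnertonDyer.Theorems.GenusExact
open Summit.BirchSwinnertonDyer.BirchSwinnertonDyer.Theorems.GenusExact.SelmerDescent
open Summit.BirchSwinnertonDyer.BirchSwinnertonDyer.Theorems.GenusExact.DeepOwnPrime
open Summit.BirchSwinnertonDyer.BirchSwinnertonDyer.Theorems.GenusExact.RelaxedCount
open Summit.BirchSwinnertonDyer.BirchSwinnertonDyer.Theorems.SchneiderFreeAdditiveX3.PoitouTateReduction

/-! ## §4 Local inputs at level `2`: the new prime (non-vanishing) and the shallow own primes (vanishing) -/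

section Local

variable (W : WeierstrassCurve ℚ) [W.IsElliptic] [W.IsGloballyMinimal]
variable (e : geomTorsion W ((2 ^ 1 : ℕ) : ℤ) → geomTorsion W ((2 ^ 1 : ℕ) : ℤ) → AlgebraicClosure ℚ)
  (hμ : ∀ S T, e S T ^ (2 ^ 1) = 1)
  (hadd₁ : ∀ S₁ S₂ T, e (S₁ + S₂) T = e S₁ T * e S₂ T)
  (hadd₂ : ∀ S T₁ T₂, e S (T₁ + T₂) = e S T₁ * e S T₂)
  (hgal : ∀ (σ : absoluteGaloisGroup ℚ) (S T : geomTorsion W ((2 ^ 1 : ℕ) : ℤ)), σ • e S T = e (σ • S) (σ • T))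

/-- **The `ℓ′`-term does NOT vanish at level `2`.**  `ℓ ≠ 2` a Gross–Kolyvagin prime (good, `Frob_ℓ = Frob_∞` on `E[2]`, index
`≥ 1`), `v` its place; the Kummer condition `𝓛_v` Lagrangian (`{}^⊥𝓛_v ≤ 𝓛_v`); `y` Kummer at `v` with `y ∉` the strict kernel
(`2^j y` strict iff `1 ≤ j`), so `loc_v y` generates `𝓛_v`; `loc_v Z ∉ 𝓛_v`.  Then `inv_v(loc_v Z ∪ₑ loc_v y) ≠ 0`.
[cite: McCallumLMS1991, §4 Prop. 4.4 and §5 Lemma 5.3] [cite: MilneADT2006, Ch. I, Cor. 2.3] -/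
theorem invWeilPairing_localization_ne_zero_of_newPrime_two (hΔ : W.Δ < 0) {K : Type} [Field K] [NumberField K]
    {ℓ : ℕ} [Fact ℓ.Prime] (hℓ2 : ℓ ≠ 2) (hgoodℓ : W.HasGoodReductionAtPrime ℓ) (hℓ : FrobEqFrobInfty W K 2 ℓ)
    {v : HeightOneSpectrum (𝓞 ℚ)} (hv : (ℓ : 𝓞 ℚ) ∈ v.asIdeal) (hidx : 1 ≤ Zhang2014.kolyvaginIndex W 2 ℓ)
    (inv : LocalInvariants ℚ (2 ^ 1))
    (hF : annLeft (invWeilPairing W (2 ^ 1) e hμ hadd₁ hadd₂ hgal inv (Sum.inr v))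
        (W.kummerSelmerStructure ((2 ^ 1 : ℕ) : ℤ) (Sum.inr v : Place ℚ)) ≤
      W.kummerSelmerStructure ((2 ^ 1 : ℕ) : ℤ) (Sum.inr v : Place ℚ))
    {Z y : galoisCohomology (W.torsionGaloisModule ((2 ^ 1 : ℕ) : ℤ)) 1}
    (hyK : y ∈ selmerLocalKer W (v.adicCompletion ℚ) ((2 ^ 1 : ℕ) : ℤ))
    (hOrd : ∀ j : ℕ, ((2 ^ j : ℕ) : ℤ) • y ∈ W.torsionLocalKer (v.adicCompletion ℚ) ((2 ^ 1 : ℕ) : ℤ) ↔ 1 ≤ j)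
    (hZ : galoisCohomology.localization (W.torsionGaloisModule ((2 ^ 1 : ℕ) : ℤ)) (Sum.inr v) 1 Z ∉
      W.kummerSelmerStructure ((2 ^ 1 : ℕ) : ℤ) (Sum.inr v : Place ℚ)) :
    invWeilPairing W (2 ^ 1) e hμ hadd₁ hadd₂ hgal inv (Sum.inr v)
      (galoisCohomology.localization (W.torsionGaloisModule ((2 ^ 1 : ℕ) : ℤ)) (Sum.inr v) 1 Z)
      (galoisCohomology.localization (W.torsionGaloisModule ((2 ^ 1 : ℕ) : ℤ)) (Sum.inr v) 1 y) ≠ 0 := by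
  haveI : NeZero (2 ^ 1) := ⟨by norm_num⟩
  intro h0
  have hgen := forall_mem_kummerSelmerStructure_exists_eq_zsmul W hΔ hℓ2 hgoodℓ hℓ hv (M := 1) le_rfl hidx (q := 2 ^ 1) rfl y hyK
    hOrd
  apply hZ
  apply hF
  rw [mem_annLeft_iff]
  intro m hm
  obtain ⟨k, hk⟩ := hgen m hm
  rw [hk, map_zsmul, h0, smul_zero]

omit [W.IsGloballyMinimal] in
/-- **The shallow-own-prime term vanishes at level `2`** (`K`-side input ⟹ `loc_ℓ Z = 0`).  `ℓ ≠ 2` a Gross–Kolyvagin prime with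
`Frob_ℓ = Frob_∞` on `E[2]`, `ℓ ∤ c` (`K = ℚ(θ)`, `θ² = c`), `λ ∣ ℓ` inert; if Q2's second clause `res Z ∈ strict(K_λ) ↔ c^{(ℓ)} ∈
strict(K_λ)` holds with `c^{(ℓ)} = 0` (the swap `(n/ℓ)ℓ′` is IMPRIMITIVE at level `2`), then `loc_ℓ Z = 0` (gk2-p3's dictionary
`zsmul_mem_torsionLocalKer_iff_resTorsion_of_notMem`, `M = 1`). [cite: McCallumLMS1991, §4 Prop. 4.4, §3 (3)] [cite: GrossLMS1991, Prop. 6.2 (2)] -/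
theorem localization_eq_zero_of_K_two (hΔ : W.Δ < 0) {K : Type} [Field K] [NumberField K]
    {ℓ : ℕ} (hℓp : ℓ.Prime) (hℓ2 : ℓ ≠ 2) {v : HeightOneSpectrum (𝓞 ℚ)} (hℓv : (ℓ : 𝓞 ℚ) ∈ v.asIdeal)
    (hgood : W.HasGoodReductionAt v) (h2K : Module.finrank ℚ K = 2) {θ : K} (hθ : θ ∉ (algebraMap ℚ K).range) {c : ℤ}
    (hc : θ ^ 2 = algebraMap ℚ K c) (hcv : ((c : ℤ) : 𝓞 ℚ) ∉ v.asIdeal) (hFrob : FrobEqFrobInfty W K (2 ^ 1) ℓ)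
    (w : HeightOneSpectrum (𝓞 K)) [w.asIdeal.LiesOver v.asIdeal] (hf : w.asIdeal.inertiaDeg (𝓞 ℚ) = 2)
    {Z : galoisCohomology (W.torsionGaloisModule ((2 ^ 1 : ℕ) : ℤ)) 1} {cK' cKu : galH1Torsion (W.baseChange K) ((2 ^ 1 : ℕ) : ℤ)}
    (hZ : resTorsion W K ((2 ^ 1 : ℕ) : ℤ) Z = cK')
    (hRel : cK' ∈ (W.baseChange K).torsionLocalKer (w.adicCompletion K) ((2 ^ 1 : ℕ) : ℤ) ↔
      cKu ∈ (W.baseChange K).torsionLocalKer (w.adicCompletion K) ((2 ^ 1 : ℕ) : ℤ))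
    (hcKu : cKu = 0) :
    galoisCohomology.localization (W.torsionGaloisModule ((2 ^ 1 : ℕ) : ℤ)) (Sum.inr v) 1 Z = 0 := by
  haveI : NeZero (2 ^ 1) := ⟨by norm_num⟩
  have hK0 : (1 : ℤ) • cK' ∈ (W.baseChange K).torsionLocalKer (w.adicCompletion K) ((2 ^ 1 : ℕ) : ℤ) := by
    rw [one_zsmul, hRel, hcKu]; exact AddSubgroup.zero_mem _
  have hv1 : (1 : ℤ) • Z ∈ W.torsionLocalKer (v.adicCompletion ℚ) ((2 ^ 1 : ℕ) : ℤ) := by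
    rw [← hZ] at hK0
    exact (zsmul_mem_torsionLocalKer_iff_resTorsion_of_notMem W hΔ (M := 1) le_rfl (q := 2 ^ 1) rfl hℓp hℓ2 hℓv hgood h2K hθ
      hc hcv hFrob w hf Z 1).mpr hK0
  have h := localization_zsmul_eq_zero_of_mem_torsionLocalKer W (2 ^ 1) v Z 1 hv1
  rwa [one_zsmul] at h

end Local

/-! ## §5 THE ONE-STEP ENGINE AT LEVEL `2`, ASSEMBLED -/

section Engine

variable (W : WeierstrassCurve ℚ) [W.IsElliptic] [W.IsGloballyMinimal]

/-- **The one-step engine of W-UP at level `2`, modulo named inputs.**  `E/ℚ` globally minimal, `Δ < 0`; `K = ℚ(θ)`, `θ² = c`,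
imaginary quadratic; `u` the genus place (`#H¹(ℚ_u, E[2]) ≤ 4`, e.g. `|d_K|` prime); (desc-fin) displayed as `hdesc`; `s ≠ ∅` (shallow)
and `t` (deep) disjoint sets of places of Gross–Kolyvagin primes of index `≥ 1` avoiding `u`; a class `b ≠ 0` (the descended
minimal class `desc c₁(n)`) Kummer off `s ∪ {u} ∪ t`, zero on `s`, transverse on `t`.  Suppose that for EVERY auxiliary `y ≠ 0`, Kummer
off `s ∪ {u} ∪ t` and zero at `u`, one finds (as the Kolyvagin machine does: a deep Čebotarev prime `ℓ′` for `(c₁(n), res_K y)`,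
`Z = desc c₁(nℓ′)`): a new Gross–Kolyvagin place `ℓ′ ∉ s ∪ {u} ∪ t`, `ℓ′ ∤ 2c`, inert `λ′ ∣ ℓ′`; classes `Z ∈ H¹(ℚ, E[2])`,
`c_K = c₁(n)`, `c_K′ = c₁(nℓ′)` with `res_K Z = c_K′`; (Kum) `c_K′` Selmer at the places of `K` over every `v ∉ s ∪ {u} ∪ t ∪ {ℓ′}`;
(Q2) at `λ′`; (Čeb) strict-kernel clauses with exponent `1` for `c_K` and `res_K y` at `λ′`; for each shallow `ℓ ∈ s`: inert `λ ∣ ℓ`,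
`ℓ ∤ c`, Q2's second clause at `λ` between `c_K′` and the swapped class `c_K^{(ℓ)} = c₁((n/ℓ)ℓ′)`, which VANISHES (imprimitivity);
(tr) `Z` transverse at the places of `t`.  Then `False`: the `k`-minimal primitive product has NO shallow own prime.
[cite: McCallumLMS1991, §5 proof of Prop. 5.2] [cite: GrossLMS1991, Prop. 6.2 and §9] [cite: MilneADT2006, Ch. I, Thm. 4.10] -/
theorem false_of_levelTwo_engine (hΔ : W.Δ < 0)
    {K : Type} [Field K] [NumberField K] (hK : IsImaginaryQuadratic K) {θ : K} (hθ : θ ∉ (algebraMap ℚ K).range) {c : ℤ}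
    (hc : θ ^ 2 = algebraMap ℚ K c)
    (u : HeightOneSpectrum (𝓞 ℚ))
    (hPu : Nat.card (galoisCohomology ((W.torsionGaloisModule ((2 ^ 1 : ℕ) : ℤ)).toLocal (Sum.inr u : Place ℚ)) 1) ≤ 4)
    (hdesc : ∀ (ξ : galH1Torsion W ((2 ^ 1 : ℕ) : ℤ)) (v : HeightOneSpectrum (𝓞 ℚ)), v ≠ u →
      (∀ w : HeightOneSpectrum (𝓞 K), w.under (𝓞 ℚ) = v →
        resTorsion W K ((2 ^ 1 : ℕ) : ℤ) ξ ∈ selmerLocalKer (W.baseChange K) (w.adicCompletion K) ((2 ^ 1 : ℕ) : ℤ)) →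
      ξ ∈ selmerLocalKer W (v.adicCompletion ℚ) ((2 ^ 1 : ℕ) : ℤ))
    (s t : Finset (Place ℚ)) (hst : Disjoint s t) (hs : s.Nonempty) (hus : (Sum.inr u : Place ℚ) ∉ s)
    (hut : (Sum.inr u : Place ℚ) ∉ t)
    (hTK : ∀ u' ∈ s ∪ t, ∃ (v : HeightOneSpectrum (𝓞 ℚ)) (ℓ : ℕ) (_ : Fact ℓ.Prime), u' = Sum.inr v ∧ ℓ ≠ 2 ∧ (ℓ : 𝓞 ℚ) ∈ v.asIdeal ∧
      W.HasGoodReductionAtPrime ℓ ∧ FrobEqFrobInfty W K 2 ℓ ∧ 1 ≤ Zhang2014.kolyvaginIndex W 2 ℓ)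
    {b : galoisCohomology (W.torsionGaloisModule ((2 ^ 1 : ℕ) : ℤ)) 1}
    (hbT : b ∈ kummerOutside W (2 ^ 1) (s ∪ {(Sum.inr u : Place ℚ)} ∪ t))
    (hbS : ∀ u' ∈ s, galoisCohomology.localization (W.torsionGaloisModule ((2 ^ 1 : ℕ) : ℤ)) u' 1 b = 0)
    (hbt : ∀ v : HeightOneSpectrum (𝓞 ℚ), Sum.inr v ∈ t →
      ∀ 𝔓 ∈ v.primesAbove, ∀ F c₀ : absoluteGaloisGroup ℚ, IsArithFrobAt (𝓞 ℚ) F 𝔓 →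
        IsComplexConjugation (Rat.castHom ℝ) c₀ → (∀ P : geomTorsion W ((2 ^ 1 : ℕ) : ℤ), F • P = c₀ • P) →
        ∃ P₁ : geomTorsion W ((2 ^ 1 : ℕ) : ℤ), h1Eval W _ b F = F • P₁ - P₁)
    (hb : b ≠ 0)
    (hstep : ∀ y ∈ kummerOutside W (2 ^ 1) (s ∪ {(Sum.inr u : Place ℚ)} ∪ t), y ≠ 0 →
      galoisCohomology.localization (W.torsionGaloisModule ((2 ^ 1 : ℕ) : ℤ)) (Sum.inr u) 1 y = 0 →
      ∃ (v' : HeightOneSpectrum (𝓞 ℚ)) (ℓ' : ℕ) (_ : Fact ℓ'.Prime) (w' : HeightOneSpectrum (𝓞 K))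
        (_ : w'.under (𝓞 ℚ) = v') (Z : galoisCohomology (W.torsionGaloisModule ((2 ^ 1 : ℕ) : ℤ)) 1)
        (cK cK' : galH1Torsion (W.baseChange K) ((2 ^ 1 : ℕ) : ℤ)),
        (Sum.inr v' : Place ℚ) ∉ s ∪ {(Sum.inr u : Place ℚ)} ∪ t ∧ ℓ' ≠ 2 ∧ (ℓ' : 𝓞 ℚ) ∈ v'.asIdeal ∧
        W.HasGoodReductionAtPrime ℓ' ∧ ((c : ℤ) : 𝓞 ℚ) ∉ v'.asIdeal ∧ FrobEqFrobInfty W K 2 ℓ' ∧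
        1 ≤ Zhang2014.kolyvaginIndex W 2 ℓ' ∧ w'.asIdeal.inertiaDeg (𝓞 ℚ) = 2 ∧
        resTorsion W K ((2 ^ 1 : ℕ) : ℤ) Z = cK' ∧
        (∀ v : HeightOneSpectrum (𝓞 ℚ), (Sum.inr v : Place ℚ) ∉ insert (Sum.inr v' : Place ℚ) (s ∪ {(Sum.inr u : Place ℚ)} ∪ t) →
          ∀ w : HeightOneSpectrum (𝓞 K), w.under (𝓞 ℚ) = v →
            cK' ∈ selmerLocalKer (W.baseChange K) (w.adicCompletion K) ((2 ^ 1 : ℕ) : ℤ)) ∧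
        ((cK' ∈ selmerLocalKer (W.baseChange K) (w'.adicCompletion K) ((2 ^ 1 : ℕ) : ℤ) ↔
            cK' ∈ (W.baseChange K).torsionLocalKer (w'.adicCompletion K) ((2 ^ 1 : ℕ) : ℤ)) ∧
          (cK' ∈ (W.baseChange K).torsionLocalKer (w'.adicCompletion K) ((2 ^ 1 : ℕ) : ℤ) ↔
            cK ∈ (W.baseChange K).torsionLocalKer (w'.adicCompletion K) ((2 ^ 1 : ℕ) : ℤ))) ∧
        (∀ j : ℕ, ((2 ^ j : ℕ) : ℤ) • cK ∈ (W.baseChange K).torsionLocalKer (w'.adicCompletion K) ((2 ^ 1 : ℕ) : ℤ) ↔ 1 ≤ j) ∧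
        (∀ j : ℕ, ((2 ^ j : ℕ) : ℤ) • resTorsion W K ((2 ^ 1 : ℕ) : ℤ) y ∈
          (W.baseChange K).torsionLocalKer (w'.adicCompletion K) ((2 ^ 1 : ℕ) : ℤ) ↔ 1 ≤ j) ∧
        (∀ u' ∈ s, ∃ (v : HeightOneSpectrum (𝓞 ℚ)) (ℓ : ℕ) (w : HeightOneSpectrum (𝓞 K)) (_ : w.asIdeal.LiesOver v.asIdeal)
          (cKu : galH1Torsion (W.baseChange K) ((2 ^ 1 : ℕ) : ℤ)),
          u' = Sum.inr v ∧ ℓ.Prime ∧ (ℓ : 𝓞 ℚ) ∈ v.asIdeal ∧ ((c : ℤ) : 𝓞 ℚ) ∉ v.asIdeal ∧ FrobEqFrobInfty W K 2 ℓ ∧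
          w.asIdeal.inertiaDeg (𝓞 ℚ) = 2 ∧
          (cK' ∈ (W.baseChange K).torsionLocalKer (w.adicCompletion K) ((2 ^ 1 : ℕ) : ℤ) ↔
            cKu ∈ (W.baseChange K).torsionLocalKer (w.adicCompletion K) ((2 ^ 1 : ℕ) : ℤ)) ∧
          cKu = 0) ∧
        (∀ v : HeightOneSpectrum (𝓞 ℚ), Sum.inr v ∈ t →
          ∀ 𝔓 ∈ v.primesAbove, ∀ F c₀ : absoluteGaloisGroup ℚ, IsArithFrobAt (𝓞 ℚ) F 𝔓 →
            IsComplexConjugation (Rat.castHom ℝ) c₀ → (∀ P : geomTorsion W ((2 ^ 1 : ℕ) : ℤ), F • P = c₀ • P) →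
            ∃ P₁ : geomTorsion W ((2 ^ 1 : ℕ) : ℤ), h1Eval W _ Z F = F • P₁ - P₁)) :
    False := by
  haveI : NeZero (2 ^ 1) := ⟨by norm_num⟩
  haveI : Fact (Nat.Prime 2) := ⟨Nat.prime_two⟩
  have h2K : Module.finrank ℚ K = 2 := hK.1
  -- a Weil pairing at level `2` (tree theorem) and the canonical Poitou–Tate family
  obtain ⟨e, hμ, hadd₁, hadd₂, halt, hnondeg, hgal⟩ := W.exists_weilPairing_holds (2 ^ 1) (by norm_num) (by norm_num)
  -- disjointness with the genus place
  have hsD : Disjoint s {(Sum.inr u : Place ℚ)} := Finset.disjoint_singleton_right.mpr hus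
  have hDt : Disjoint {(Sum.inr u : Place ℚ)} t := Finset.disjoint_singleton_left.mpr hut
  -- `P_D = #H¹(ℚ_u, E[2]) ≤ 4 ≤ 4^{#s}`
  have hδ : ∏ u' ∈ ({(Sum.inr u : Place ℚ)} : Finset (Place ℚ)),
      Nat.card (galoisCohomology ((W.torsionGaloisModule ((2 ^ 1 : ℕ) : ℤ)).toLocal u') 1) ≤ 4 ^ s.card := by
    rw [Finset.prod_singleton]
    have h1 : 1 ≤ s.card := Finset.card_pos.mpr hs
    calc _ ≤ 4 := hPu
      _ = 4 ^ 1 := (pow_one 4).symm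
      _ ≤ 4 ^ s.card := Nat.pow_le_pow_right (by norm_num) h1
  -- the auxiliary class and the reciprocity it feeds
  obtain ⟨y, hyKO, hy0, hyD, hrec⟩ := exists_auxiliary_levelTwo_rec W e hμ hadd₁ hadd₂ hgal halt hnondeg hΔ s {(Sum.inr u : Place ℚ)}
    t hsD hst hDt hTK hδ hbT hbS hbt hb
  have hyu : galoisCohomology.localization (W.torsionGaloisModule ((2 ^ 1 : ℕ) : ℤ)) (Sum.inr u) 1 y = 0 :=
    hyD _ (Finset.mem_singleton_self _)
  -- the step data for this `y`
  obtain ⟨v', ℓ', hℓ'p, w', hw', Z, cK, cK', hv'out, hℓ'2, hℓ'v, hgood', hcv', hFrob2', hidx', hf', hZ, hKum, hRel, hOrdZ, hOrdY,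
    hfree, htr⟩ := hstep y hyKO hy0 hyu
  subst hw'
  haveI hw'l : w'.asIdeal.LiesOver (w'.under (𝓞 ℚ)).asIdeal := ⟨by rw [HeightOneSpectrum.under_asIdeal]⟩
  have hgoodv' : W.HasGoodReductionAt (w'.under (𝓞 ℚ)) :=
    VisiblePairAtTwo.hasGoodReductionAt_of_hasGoodReductionAtPrime W hgood' hℓ'v
  have hFrob2'' : FrobEqFrobInfty W K (2 ^ 1) ℓ' := by rw [pow_one]; exact hFrob2'
  -- (hX): `Z` Kummer off `s ∪ {u} ∪ t ∪ {ℓ′}` — archimedean vanishing + (desc-fin) + (Kum)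
  have hX : Z ∈ kummerOutside W (2 ^ 1) (insert (Sum.inr (w'.under (𝓞 ℚ)) : Place ℚ) (s ∪ {(Sum.inr u : Place ℚ)} ∪ t)) := by
    refine (mem_kummerOutside_iff W (2 ^ 1) _ _).mpr ?_
    rintro (w | v) hv
    · exact (res_mem_kummerLocalConditionAt_iff W ((2 ^ 1 : ℕ) : ℤ) (Place.Completion (Sum.inl w : Place ℚ)) _).mpr
        (KolyvaginRatDescentTwo.mem_selmerLocalKer_infinitePlace_of_Δ_neg W hΔ w Z)
    · have hvu : v ≠ u := fun h ↦ hv (by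
        rw [h]
        exact Finset.mem_insert_of_mem (Finset.mem_union_left t (Finset.mem_union_right s (Finset.mem_singleton_self _))))
      exact (res_mem_kummerLocalConditionAt_iff W ((2 ^ 1 : ℕ) : ℤ) (Place.Completion (Sum.inr v : Place ℚ)) _).mpr
        (hdesc Z v hvu fun w hw ↦ by rw [hZ]; exact hKum v hv w hw)
  -- (hXs): `loc_{u'} Z = 0` at the shallow own primes
  have hXs : ∀ u' ∈ s, galoisCohomology.localization (W.torsionGaloisModule ((2 ^ 1 : ℕ) : ℤ)) u' 1 Z = 0 := by
    intro u' hu'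
    obtain ⟨v, ℓ, w, hw, cKu, huv, hℓp, hℓv, hcv, hFrob, hf, hRel₁, hcKu⟩ := hfree u' hu'
    obtain ⟨v₀, ℓ₀, hℓ₀p, huv₀, hℓ₀2, hℓ₀v, hgood₀, -, -⟩ := hTK u' (Finset.mem_union_left t hu')
    subst huv
    have hvv : v = v₀ := Sum.inr_injective huv₀
    subst hvv
    haveI := hw
    have hℓℓ : ℓ = ℓ₀ := by
      have h1 := VisiblePairAtTwo.natGenerator_eq_of_natCast_prime_mem hℓp hℓv
      have h2 := VisiblePairAtTwo.natGenerator_eq_of_natCast_prime_mem hℓ₀p.out hℓ₀v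
      exact h1.symm.trans h2
    subst hℓℓ
    have hgoodv : W.HasGoodReductionAt v := VisiblePairAtTwo.hasGoodReductionAt_of_hasGoodReductionAtPrime W hgood₀ hℓv
    have hFrob' : FrobEqFrobInfty W K (2 ^ 1) ℓ := by rw [pow_one]; exact hFrob
    exact localization_eq_zero_of_K_two W hΔ hℓp hℓ₀2 hℓv hgoodv h2K hθ hc hcv hFrob' w hf hZ hRel₁ hcKu
  -- the `ℓ′`-term vanishes …
  have hzero := hrec (Sum.inr (w'.under (𝓞 ℚ))) hv'out Z hX hXs htr
  -- … and does not vanish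
  have h2v' : ((2 : ℕ) : 𝓞 ℚ) ∉ (w'.under (𝓞 ℚ)).asIdeal := LocalDualityOrder.two_notMem_of_odd_prime_mem hℓ'2 hℓ'v
  have hyK : y ∈ selmerLocalKer W ((w'.under (𝓞 ℚ)).adicCompletion ℚ) ((2 ^ 1 : ℕ) : ℤ) :=
    (res_mem_kummerLocalConditionAt_iff W ((2 ^ 1 : ℕ) : ℤ) (Place.Completion (Sum.inr (w'.under (𝓞 ℚ)) : Place ℚ)) y).mp
      ((mem_kummerOutside_iff W (2 ^ 1) _ y).mp hyKO _ hv'out)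
  have hOrdYℚ : ∀ j : ℕ, ((2 ^ j : ℕ) : ℤ) • y ∈ W.torsionLocalKer ((w'.under (𝓞 ℚ)).adicCompletion ℚ) ((2 ^ 1 : ℕ) : ℤ) ↔
      1 ≤ j := fun j ↦
    (zsmul_mem_torsionLocalKer_iff_resTorsion_of_notMem W hΔ (M := 1) le_rfl (q := 2 ^ 1) rfl hℓ'p.out hℓ'2 hℓ'v hgoodv' h2K hθ
      hc hcv' hFrob2'' w' hf' y _).trans (hOrdY j)
  -- `res Z = c_K′` is not Selmer at `λ′` (Q2 + the Čebotarev clause), hence `loc Z ∉ 𝓛_{ℓ′}`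
  have hcK'not : cK' ∉ selmerLocalKer (W.baseChange K) (w'.adicCompletion K) ((2 ^ 1 : ℕ) : ℤ) := by
    intro h
    have h1 : cK ∈ (W.baseChange K).torsionLocalKer (w'.adicCompletion K) ((2 ^ 1 : ℕ) : ℤ) := hRel.2.mp (hRel.1.mp h)
    have h2 := (hOrdZ 0).mp (by rw [pow_zero, Nat.cast_one, one_smul]; exact h1)
    omega
  have hZnot : Z ∉ selmerLocalKer W ((w'.under (𝓞 ℚ)).adicCompletion ℚ) ((2 ^ 1 : ℕ) : ℤ) :=
    KolyvaginRatDescentTwo.not_mem_selmerLocalKer_of_resTorsion_not_mem K W ((2 ^ 1 : ℕ) : ℤ) w' (by rw [hZ]; exact hcK'not)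
  have hZL : galoisCohomology.localization (W.torsionGaloisModule ((2 ^ 1 : ℕ) : ℤ)) (Sum.inr (w'.under (𝓞 ℚ))) 1 Z ∉
      W.kummerSelmerStructure ((2 ^ 1 : ℕ) : ℤ) (Sum.inr (w'.under (𝓞 ℚ)) : Place ℚ) := fun h ↦
    hZnot (mem_selmerLocalKer_of_mem_kummerLocalConditionAt_res W ((2 ^ 1 : ℕ) : ℤ) ((w'.under (𝓞 ℚ)).adicCompletion ℚ) h)
  have hF := annLeft_invWeilPairing_kummerSelmerStructure_le_canonical W e hμ hadd₁ hadd₂ hgal halt hnondeg (p := 2) (k := 1)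
    one_ne_zero (w'.under (𝓞 ℚ)) h2v'
  exact invWeilPairing_localization_ne_zero_of_newPrime_two W e hμ hadd₁ hadd₂ hgal hΔ hℓ'2 hgood' hFrob2' hℓ'v hidx'
    (LocalInvariants.canonical ℚ (2 ^ 1)) hF hyK hOrdYℚ hZL hzero

end Engine

end Summit.BirchSwinnertonDyer.BirchSwinnertonDyer.Theorems.KolyvaginLowerTwo

end
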